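import Summits.ResolutionOfSingularities.ResolutionOfSingularities.Theorems.EquisingularLiftEquisingularLiftNatTowerRationalDefs
import HarnessLib

/-!
# [OURS · L1 W4.5(b) · EL♮(3)] HSUB′(ReachTower₀) — THE TOWER-STAGE INVARIANT `Tower.Inv₁` (definitions)
# (the `INV₁ F₉ Z₉ hZ₉ F₁₀ υ' G γ T E K` of the driver `hsub_reachTower_of_invariant`, …NatTowerDriver p549473)

res-D-pv-029 g8 (HSUB′(ReachTower)₃ ASSEMBLY, res-L1-w45b-plan-1 NAMING 2026-08-27T16:17:51Z; RULING-5 16:37:19Z (γ-cone base clause +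
γ-forget coupling clause, worded by res-L1-w45b-lead-2 with the tower re-cut); design findings STATUS 16:31:11Z §F / 16:37:13Z (F5)/(S2)).
OURS; NOT a statement of any manuscript; AI-written, weaker than expert review. Definitions + pure-logic projections only.

WHAT `Tower.Inv₁ O k θ P q Y Ch Ruled F₉ Z₉ hZ₉ F₁₀ υ' G γ T E K` RECORDS for a downstairs tower stage `(G, γ, T, E, K)` over the seed stage
`F₁₀` (after the carrier-curve blow-up `υ' : F₁₀ → F₉` of `Z₉`):
* context: `υ'` is the blow-up of `𝓘⟨Z₉⟩` and `Z₉` is infinite (a curve; rounds inside a surface lying over finitely many points of `F₉` are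
  then impossible — `Tower.NoRound`);
* downstairs bookkeeping: `G` integral, `T` closed irreducible, `E` closed, `T ⊄ E`;
* the upstairs `Ch`-stage `(X, σ, S)` with its model square `jG : G → X` over `Spec θ` and `jG '' T = S` (K5′'s currency);
* the EXCEPTIONAL SURFACE `E`: EITHER `E` can host no round (`Tower.NoRound`: its image in `F₉` is finite — the exceptional plane of a point
  step), OR an upstairs ideal sheaf `𝓔` with (e-i) exact reduced trace `𝓔.comap jG = 𝓘⟨E⟩`, (e-ii) locally principal, (e-iii) `V(𝓔)` regular,
  (e-iv) `σ '' supp 𝓔` off the generic point of `Y`, (e-v) the RULED-SURFACE DATUM `Ruled … X σ jG 𝓔` — an explicit PARAMETER of this file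
  (the input currency of the Čech-round supplier T-DIRLIFT / T-PROJDICT of res-L1-w45b-stub-2 / res-type-027: «`V(𝓔)` is a `ℙ¹`-bundle over the
  lifted carrier», to be instantiated by their predicate; every brick of the assembly is stated for the `Ruled` it is proved for);
* the CONE SHADOW `K` (only next to a round-ready `𝓔`): EITHER forgotten (`K = ∅`, RULING-5's γ-forget — `ConeWitness` then never fires) OR an
  upstairs ideal sheaf `𝒦` with (k-i) `𝒦` locally principal, (k-ii) exact reduced trace `𝒦.comap jG = 𝓘⟨closure K⟩`, (k-iii) `V(𝓔 ⊔ 𝒦) → Spec O`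
  flat, (k-iv) CONDITIONAL REGULARITY: at a special point `jG y` of `V(𝓔 ⊔ 𝒦)` where the downstairs intersection `E ∩ closure K` is reduced
  (`(𝓘⟨E⟩ ⊔ 𝓘⟨closure K⟩)_y = 𝓘⟨E ∩ closure K⟩_y` — what `ConeWitness` asserts globally), the quotient stalk `𝒪_{X,jG y} ⧸ (𝓔 ⊔ 𝒦)` is regular.
  (k-iv) is genuinely datum, not a consequence of (k-i)–(k-iii): by hand, `E = {z = 0}`, `K = {z = xy}` meet in the reduced nodal `V(z, xy)` while the
  lift `V(z, z − xy)` is not regular at the node; it holds where the architecture creates the pair (curve step: `V(𝓔 ⊔ St K) ≅ C₉`; cone round: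
  `≅` the previous centre, res-D-pv-051 p547344 / p549332; Čech round off `closure K`: simple-root argument on `Γ̃ ∩ V(𝒦)`) and transports along the
  isomorphisms `V(St 𝓔) ≅ V(𝓔)` of rounds and along steps away from `E` / `closure K`. At a cone round all special points of `V(𝓔 ⊔ 𝒦)` satisfy
  the hypothesis of (k-iv), whence `V(𝓔 ⊔ 𝒦)` is regular (closed points are special; localisation), `O`-flat (k-iii), with exact trace
  `Z = E ∩ closure K` ((e-i), (k-ii)) — the inputs of res-D-pv-051's `coneRound` (p545368) up to its Cartier clause, which follows from (k-iii).
`Tower.inv₁_final` = the driver's (final) clause read off the stage conjuncts (pure logic).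
-/

set_option linter.dupNamespace false -- mandated namespace `Summit.<Summit>.<Problem>` of this single-conjunct summit

noncomputable section

open CategoryTheory CategoryTheory.Limits AlgebraicGeometry TopologicalSpace Topology IsLocalRing
open Literature.AlgebraicGeometry.Resolution
open AlgebraicGeometry.Scheme.IdealSheafData

namespace Summit.ResolutionOfSingularities.ResolutionOfSingularities.Cruxes.EquisingularLiftNat.Sections.Tower

variable (O : Type) [CommRing O] (k : Type) [Field k] (θ : O →+* k)
  (P : Scheme.{0}) (q : P ⟶ Spec (.of O)) (Y : Set P) (Ch : ∀ X' : Scheme.{0}, (X' ⟶ P) → Set X' → Prop)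

/-- The type of the RULED-SURFACE DATUM parameter of `Tower.Inv₁` (see the module docstring): a predicate on the tower context
`(F₉, Z₉, F₁₀, υ')`, the downstairs stage `(G, γ, E)` and the upstairs realisation `(X, σ, jG, 𝓔)` of the exceptional surface. -/
abbrev RuledDatum : Type 1 :=
  ∀ (F₉ : Scheme.{0}) (Z₉ : Set F₉), IsClosed Z₉ → ∀ (F₁₀ : Scheme.{0}), (F₁₀ ⟶ F₉) →
    ∀ (G : Scheme.{0}), (G ⟶ F₁₀) → Set G → ∀ (X : Scheme.{0}), (X ⟶ P) → (G ⟶ X) → X.IdealSheafData → Prop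

/-- **No round can live inside `E`**: the image of `E` in `F₉` is finite (so no closed `Z ⊆ E` maps onto the infinite carrier curve `Z₉` —
`TowerFull` fails). The exceptional plane of a point step is such an `E`. Downstairs only. [OURS · L1 W4.5b] -/
def NoRound {F₉ F₁₀ : Scheme.{0}} (υ' : F₁₀ ⟶ F₉) (G : Scheme.{0}) (γ : G ⟶ F₁₀) (E : Set G) : Prop :=
  ((γ ≫ υ') '' E).Finite

/-- **The cone-shadow datum next to a round-ready exceptional surface `𝓔`** (clauses (k-i)–(k-iv) of the module docstring), or the
shadow forgotten (`K = ∅`). [OURS · L1 W4.5b] -/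
def Shadow (G : Scheme.{0}) (E : Set G) (hE : IsClosed E) (K : Set G)
    (X : Scheme.{0}) (σ : X ⟶ P) (jG : G ⟶ X) (𝓔 : X.IdealSheafData) : Prop :=
  K = ∅ ∨ ∃ 𝒦 : X.IdealSheafData,
    -- (k-i) locally principal
    (∀ z : X, (stalkIdeal 𝒦 z).IsPrincipal) ∧
    -- (k-ii) exact reduced trace = the downstairs shadow
    𝒦.comap jG = vanishingIdeal (⟨closure K, isClosed_closure⟩ : Closeds G) ∧
    -- (k-iii) the pair is flat over `O`
    Flat ((𝓔 ⊔ 𝒦).subschemeι ≫ σ ≫ q) ∧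
    -- (k-iv) conditional regularity of the pair at the special points where `E ∩ closure K` is reduced
    (∀ y : G, jG y ∈ ((𝓔 ⊔ 𝒦).support : Set X) →
      stalkIdeal (vanishingIdeal (⟨E, hE⟩ : Closeds G) ⊔ vanishingIdeal (⟨closure K, isClosed_closure⟩ : Closeds G)) y =
        stalkIdeal (vanishingIdeal (⟨E ∩ closure K, hE.inter isClosed_closure⟩ : Closeds G)) y →
      IsRegularLocalRing (X.presheaf.stalk (jG y) ⧸ stalkIdeal (𝓔 ⊔ 𝒦) (jG y)))

/-- **The exceptional-surface datum of a tower stage**: `E` hosts no round, or an upstairs `𝓔` with (e-i)–(e-v) of the module docstring and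
the cone shadow next to it. [OURS · L1 W4.5b] -/
def Exc (Ruled : RuledDatum P) {F₉ : Scheme.{0}} (Z₉ : Set F₉) (hZ₉ : IsClosed Z₉) {F₁₀ : Scheme.{0}} (υ' : F₁₀ ⟶ F₉)
    (G : Scheme.{0}) (γ : G ⟶ F₁₀) (E : Set G) (hE : IsClosed E) (K : Set G)
    (X : Scheme.{0}) (σ : X ⟶ P) (jG : G ⟶ X) : Prop :=
  NoRound υ' G γ E ∨ ∃ 𝓔 : X.IdealSheafData,
    -- (e-i) exact reduced trace
    𝓔.comap jG = vanishingIdeal (⟨E, hE⟩ : Closeds G) ∧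
    -- (e-ii) locally principal, (e-iii) regular
    (∀ z : X, (stalkIdeal 𝓔 z).IsPrincipal) ∧ Scheme.IsRegular 𝓔.subscheme ∧
    -- (e-iv) off the generic point of `Y`
    σ '' (𝓔.support : Set X) ⊆ {p : P | ¬ IsGenericPoint p Y} ∧
    -- (e-v) the ruled-surface datum (T-DIRLIFT's input currency)
    Ruled F₉ Z₉ hZ₉ F₁₀ υ' G γ E X σ jG 𝓔 ∧
    -- the cone shadow next to `𝓔`
    Shadow O P q G E hE K X σ jG 𝓔

/-- **The tower-stage invariant `INV₁ F₉ Z₉ hZ₉ F₁₀ υ' G γ T E K`** of the driver `hsub_reachTower_of_invariant` (…NatTowerDriver): context,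
downstairs bookkeeping, the upstairs `Ch`-stage with its model square, and the exceptional-surface / cone-shadow datum `Tower.Exc`.
[OURS · L1 W4.5b] -/
def Inv₁ (Ruled : RuledDatum P) (F₉ : Scheme.{0}) (Z₉ : Set F₉) (hZ₉ : IsClosed Z₉) (F₁₀ : Scheme.{0}) (υ' : F₁₀ ⟶ F₉)
    (G : Scheme.{0}) (γ : G ⟶ F₁₀) (T E K : Set G) : Prop :=
  -- context
  IsBlowup υ' (vanishingIdeal (⟨Z₉, hZ₉⟩ : Closeds F₉)) ∧ Z₉.Infinite ∧
  -- downstairs bookkeeping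
  IsIntegral G ∧ IsClosed T ∧ IsIrreducible T ∧ IsClosed E ∧ ¬ T ⊆ E ∧
  -- the upstairs stage
  ∃ (X : Scheme.{0}) (σ : X ⟶ P) (S : Set X) (jG : G ⟶ X) (tG : G ⟶ Spec (.of k)),
    Ch X σ S ∧ IsIntegral X ∧ IsLocallyNoetherian X ∧ Scheme.IsRegular X ∧ IsDominant (σ ≫ q) ∧
    IsPullback jG tG (σ ≫ q) (Spec.map (CommRingCat.ofHom θ)) ∧ jG '' T = S ∧
    -- the exceptional surface and the cone shadow
    (∀ hE : IsClosed E, Exc O P q Y Ruled Z₉ hZ₉ υ' G γ E hE K X σ jG)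

/-! ## Pure-logic projections -/

/-- **The driver's (final) clause from `Tower.Inv₁`**: the `Ch`-stage with its model square, read off the invariant. [OURS · pure logic] -/
theorem inv₁_final (Ruled : RuledDatum P) (F₉ : Scheme.{0}) (Z₉ : Set F₉) (hZ₉ : IsClosed Z₉) (F₁₀ : Scheme.{0}) (υ' : F₁₀ ⟶ F₉)
    (G : Scheme.{0}) (γ : G ⟶ F₁₀) (T E K : Set G) (h : Inv₁ O k θ P q Y Ch Ruled F₉ Z₉ hZ₉ F₁₀ υ' G γ T E K) :
    ∃ (X₉ : Scheme.{0}) (σ₉ : X₉ ⟶ P) (S₉ : Set X₉) (j₉ : G ⟶ X₉) (t₉ : G ⟶ Spec (.of k)),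
      Ch X₉ σ₉ S₉ ∧ IsIntegral X₉ ∧ IsLocallyNoetherian X₉ ∧ Scheme.IsRegular X₉ ∧ IsDominant (σ₉ ≫ q) ∧
      IsPullback j₉ t₉ (σ₉ ≫ q) (Spec.map (CommRingCat.ofHom θ)) ∧ j₉ '' T = S₉ ∧ IsClosed T ∧ IsIrreducible T ∧ IsIntegral G := by
  obtain ⟨-, -, hG, hT, hTirr, -, -, X, σ, S, jG, tG, hCh, hX, hXn, hXr, hdom, hsq, hTS, -⟩ := h
  exact ⟨X, σ, S, jG, tG, hCh, hX, hXn, hXr, hdom, hsq, hTS, hT, hTirr, hG⟩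

/-- A surface hosting no round hosts no round: `NoRound` and `Z₉` infinite contradict `TowerFull` for a nonempty closed `Z ⊆ E`.
[OURS · elementary] -/
theorem not_towerFull_of_noRound {F₉ F₁₀ : Scheme.{0}} (υ' : F₁₀ ⟶ F₉) (Z₉ : Set F₉) (hZ₉ : IsClosed Z₉) (hinf : Z₉.Infinite)
    (G : Scheme.{0}) (γ : G ⟶ F₁₀) (E : Set G) (hno : NoRound υ' G γ E) (Z : Set G) (hZ : IsClosed Z) (hZE : Z ⊆ E) :
    ¬ TowerFull F₉ F₁₀ υ' Z₉ hZ₉ G γ Z hZ := by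
  rintro ⟨δ, hδ, -, -, hsurj⟩
  apply hinf
  -- every point of `Z₉` is the image of a point of `Z ⊆ E`
  refine hno.subset ?_
  intro z hz
  have hz' : z ∈ Set.range (redSubι F₉ Z₉ hZ₉) := by
    rw [Scheme.IdealSheafData.range_subschemeι, Scheme.IdealSheafData.coe_support_vanishingIdeal]; exact hz
  obtain ⟨w, rfl⟩ := hz'
  obtain ⟨v, rfl⟩ := hsurj w
  refine ⟨redSubι G Z hZ v, hZE ?_, ?_⟩
  · have h1 : redSubι G Z hZ v ∈ Set.range (redSubι G Z hZ) := ⟨v, rfl⟩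
    rw [Scheme.IdealSheafData.range_subschemeι, Scheme.IdealSheafData.coe_support_vanishingIdeal] at h1
    exact h1
  · symm
    change (δ ≫ redSubι F₉ Z₉ hZ₉) v = (redSubι G Z hZ ≫ γ ≫ υ') v
    rw [hδ]

/-! ## Successor predicates with the two CARTIER clauses of the cone round (appended 2026-08-27T18:50Z, res-D-pv-029 g8)

res-D-pv-051's cone-round bricks (…NatConeRoundCartier p545368 / …Centre p547344 / …Transport p549332) take TWO Cartier hypotheses:
`IsEffectiveCartier (𝓔.comap 𝒦.subschemeι)` («`E` cuts an effective Cartier divisor on the cone» — `coneRound`, `coneRound_shadow_comap`)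
and `IsEffectiveCartier (𝒦.comap 𝓔.subschemeι)` («the cone cuts an effective Cartier divisor on `E`» — `coneRound_exceptional_comap`, the
old surface through a cone round). Neither follows cheaply from `Tower.Shadow`'s (k-i)–(k-iv) (it is a no-common-component statement; by hand
`𝒦 = 𝓔 · 𝒦′` passes (k-i)–(k-iii)), so they are RECORDED as (k-v), (k-vi) in `Tower.Shadow₂`; `Tower.Exc₂` / `Tower.Inv₂` are `Exc` / `Inv₁`
with `Shadow₂`. They hold where the pair is CREATED — curve step: (k-v) = `isEffectiveCartier_cone_next` (saturation), (k-vi) on the chart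
`U_σ̃` of the blow-up of `(σ̃, κ)`: `St K = (κ/σ̃)` is a VARIABLE of `(𝒪/(σ̃, κ))[T] ≅ B/(σ̃)` (Stacks 0BIQ); cone round: the same two facts
for the new pair; Čech round off `closure K`: both reduce to `τ^*κ ∉ (e)` over `Γ̃ ∩ V(𝒦)` — and transport along the isomorphisms of the
steps away from `V(𝓔) ∪ V(𝒦)` (Literature `IsEffectiveCartier.comap_iso`). The bricks of the assembly conclude `Tower.Inv₂`; `inv₂_inv₁`
recovers `Tower.Inv₁`. -/

/-- **The cone-shadow datum with the two Cartier clauses** (k-i)–(k-vi): `Tower.Shadow`'s `∃ 𝒦` branch ∧ (k-v) `E|_{V(𝒦)}` and (k-vi)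
`V(𝒦)|_{V(𝓔)}` effective Cartier; or the shadow forgotten (`K = ∅`). [OURS · L1 W4.5b] -/
def Shadow₂ (G : Scheme.{0}) (E : Set G) (hE : IsClosed E) (K : Set G)
    (X : Scheme.{0}) (σ : X ⟶ P) (jG : G ⟶ X) (𝓔 : X.IdealSheafData) : Prop :=
  K = ∅ ∨ ∃ 𝒦 : X.IdealSheafData,
    -- (k-i) locally principal
    (∀ z : X, (stalkIdeal 𝒦 z).IsPrincipal) ∧
    -- (k-ii) exact reduced trace = the downstairs shadow
    𝒦.comap jG = vanishingIdeal (⟨closure K, isClosed_closure⟩ : Closeds G) ∧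
    -- (k-iii) the pair is flat over `O`
    Flat ((𝓔 ⊔ 𝒦).subschemeι ≫ σ ≫ q) ∧
    -- (k-iv) conditional regularity of the pair at the special points where `E ∩ closure K` is reduced
    (∀ y : G, jG y ∈ ((𝓔 ⊔ 𝒦).support : Set X) →
      stalkIdeal (vanishingIdeal (⟨E, hE⟩ : Closeds G) ⊔ vanishingIdeal (⟨closure K, isClosed_closure⟩ : Closeds G)) y =
        stalkIdeal (vanishingIdeal (⟨E ∩ closure K, hE.inter isClosed_closure⟩ : Closeds G)) y →
      IsRegularLocalRing (X.presheaf.stalk (jG y) ⧸ stalkIdeal (𝓔 ⊔ 𝒦) (jG y))) ∧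
    -- (k-v) `E` cuts an effective Cartier divisor on the cone `V(𝒦)` (res-D-pv-051's `hE𝒦`)
    IsEffectiveCartier (𝓔.comap 𝒦.subschemeι) ∧
    -- (k-vi) the cone cuts an effective Cartier divisor on `V(𝓔)` (res-D-pv-051's `hK𝓔`)
    IsEffectiveCartier (𝒦.comap 𝓔.subschemeι)

/-- **The exceptional-surface datum with `Shadow₂`** (otherwise = `Tower.Exc`). [OURS · L1 W4.5b] -/
def Exc₂ (Ruled : RuledDatum P) {F₉ : Scheme.{0}} (Z₉ : Set F₉) (hZ₉ : IsClosed Z₉) {F₁₀ : Scheme.{0}} (υ' : F₁₀ ⟶ F₉)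
    (G : Scheme.{0}) (γ : G ⟶ F₁₀) (E : Set G) (hE : IsClosed E) (K : Set G)
    (X : Scheme.{0}) (σ : X ⟶ P) (jG : G ⟶ X) : Prop :=
  NoRound υ' G γ E ∨ ∃ 𝓔 : X.IdealSheafData,
    𝓔.comap jG = vanishingIdeal (⟨E, hE⟩ : Closeds G) ∧
    (∀ z : X, (stalkIdeal 𝓔 z).IsPrincipal) ∧ Scheme.IsRegular 𝓔.subscheme ∧
    σ '' (𝓔.support : Set X) ⊆ {p : P | ¬ IsGenericPoint p Y} ∧
    Ruled F₉ Z₉ hZ₉ F₁₀ υ' G γ E X σ jG 𝓔 ∧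
    Shadow₂ O P q G E hE K X σ jG 𝓔

/-- **The tower-stage invariant with the Cartier clauses, `Tower.Inv₂`** — `Tower.Inv₁` with `Exc₂`; THIS is the `INV₁` the assembly
instantiates the driver with. [OURS · L1 W4.5b] -/
def Inv₂ (Ruled : RuledDatum P) (F₉ : Scheme.{0}) (Z₉ : Set F₉) (hZ₉ : IsClosed Z₉) (F₁₀ : Scheme.{0}) (υ' : F₁₀ ⟶ F₉)
    (G : Scheme.{0}) (γ : G ⟶ F₁₀) (T E K : Set G) : Prop :=
  IsBlowup υ' (vanishingIdeal (⟨Z₉, hZ₉⟩ : Closeds F₉)) ∧ Z₉.Infinite ∧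
  IsIntegral G ∧ IsClosed T ∧ IsIrreducible T ∧ IsClosed E ∧ ¬ T ⊆ E ∧
  ∃ (X : Scheme.{0}) (σ : X ⟶ P) (S : Set X) (jG : G ⟶ X) (tG : G ⟶ Spec (.of k)),
    Ch X σ S ∧ IsIntegral X ∧ IsLocallyNoetherian X ∧ Scheme.IsRegular X ∧ IsDominant (σ ≫ q) ∧
    IsPullback jG tG (σ ≫ q) (Spec.map (CommRingCat.ofHom θ)) ∧ jG '' T = S ∧
    (∀ hE : IsClosed E, Exc₂ O P q Y Ruled Z₉ hZ₉ υ' G γ E hE K X σ jG)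

/-- `Shadow₂ ⇒ Shadow` (drop (k-v), (k-vi)). [OURS · pure logic] -/
theorem shadow₂_shadow {G : Scheme.{0}} {E : Set G} {hE : IsClosed E} {K : Set G} {X : Scheme.{0}} {σ : X ⟶ P} {jG : G ⟶ X}
    {𝓔 : X.IdealSheafData} (h : Shadow₂ O P q G E hE K X σ jG 𝓔) : Shadow O P q G E hE K X σ jG 𝓔 := by
  rcases h with h | ⟨𝒦, h1, h2, h3, h4, -, -⟩
  · exact Or.inl h
  · exact Or.inr ⟨𝒦, h1, h2, h3, h4⟩

/-- `Exc₂ ⇒ Exc`. [OURS · pure logic] -/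
theorem exc₂_exc (Ruled : RuledDatum P) {F₉ : Scheme.{0}} {Z₉ : Set F₉} {hZ₉ : IsClosed Z₉} {F₁₀ : Scheme.{0}} {υ' : F₁₀ ⟶ F₉}
    {G : Scheme.{0}} {γ : G ⟶ F₁₀} {E : Set G} {hE : IsClosed E} {K : Set G} {X : Scheme.{0}} {σ : X ⟶ P} {jG : G ⟶ X}
    (h : Exc₂ O P q Y Ruled Z₉ hZ₉ υ' G γ E hE K X σ jG) : Exc O P q Y Ruled Z₉ hZ₉ υ' G γ E hE K X σ jG := by
  rcases h with h | ⟨𝓔, h1, h2, h3, h4, h5, h6⟩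
  · exact Or.inl h
  · exact Or.inr ⟨𝓔, h1, h2, h3, h4, h5, shadow₂_shadow O P q h6⟩

/-- `Tower.Inv₂ ⇒ Tower.Inv₁`. [OURS · pure logic] -/
theorem inv₂_inv₁ (Ruled : RuledDatum P) (F₉ : Scheme.{0}) (Z₉ : Set F₉) (hZ₉ : IsClosed Z₉) (F₁₀ : Scheme.{0}) (υ' : F₁₀ ⟶ F₉)
    (G : Scheme.{0}) (γ : G ⟶ F₁₀) (T E K : Set G) (h : Inv₂ O k θ P q Y Ch Ruled F₉ Z₉ hZ₉ F₁₀ υ' G γ T E K) :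
    Inv₁ O k θ P q Y Ch Ruled F₉ Z₉ hZ₉ F₁₀ υ' G γ T E K := by
  obtain ⟨h1, h2, h3, h4, h5, h6, h7, X, σ, S, jG, tG, hCh, hX, hXn, hXr, hdom, hsq, hTS, hexc⟩ := h
  exact ⟨h1, h2, h3, h4, h5, h6, h7, X, σ, S, jG, tG, hCh, hX, hXn, hXr, hdom, hsq, hTS, fun hE => exc₂_exc O P q Y Ruled (hexc hE)⟩

/-- **The driver's (final) clause from `Tower.Inv₂`.** [OURS · pure logic] -/
theorem inv₂_final (Ruled : RuledDatum P) (F₉ : Scheme.{0}) (Z₉ : Set F₉) (hZ₉ : IsClosed Z₉) (F₁₀ : Scheme.{0}) (υ' : F₁₀ ⟶ F₉)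
    (G : Scheme.{0}) (γ : G ⟶ F₁₀) (T E K : Set G) (h : Inv₂ O k θ P q Y Ch Ruled F₉ Z₉ hZ₉ F₁₀ υ' G γ T E K) :
    ∃ (X₉ : Scheme.{0}) (σ₉ : X₉ ⟶ P) (S₉ : Set X₉) (j₉ : G ⟶ X₉) (t₉ : G ⟶ Spec (.of k)),
      Ch X₉ σ₉ S₉ ∧ IsIntegral X₉ ∧ IsLocallyNoetherian X₉ ∧ Scheme.IsRegular X₉ ∧ IsDominant (σ₉ ≫ q) ∧
      IsPullback j₉ t₉ (σ₉ ≫ q) (Spec.map (CommRingCat.ofHom θ)) ∧ j₉ '' T = S₉ ∧ IsClosed T ∧ IsIrreducible T ∧ IsIntegral G :=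
  inv₁_final O k θ P q Y Ch Ruled F₉ Z₉ hZ₉ F₁₀ υ' G γ T E K (inv₂_inv₁ O k θ P q Y Ch Ruled F₉ Z₉ hZ₉ F₁₀ υ' G γ T E K h)

/-! ## Successor predicates with the LOCALIZED shadow trace (k-ii-loc) (appended 2026-08-27T21:15Z, res-D-pv-029 g8; res-type-100's S7
FINDING 20:46:11Z / res-D-pv-029 DECISION 20:53:20Z): `Shadow₃`/`Exc₃`/`Inv₃` = `Shadow₂`/`Exc₂`/`Inv₂` with (k-ii) «`𝒦·𝒪_G = 𝓘⟨closure K⟩`»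
replaced by (k-ii-loc) «equality RESTRICTED to an open `V ⊇ E`» (the exceptional surfaces lie over the seed point `x`, where the B-series cone
IS the prescribed shadow; away from `x` its fibre may have other components). The centre exactness `(𝓔 ⊔ 𝒦)·𝒪_G = 𝓘⟨Z⟩` of a cone round
needs (k-ii) only on `V ⊇ E` (off `E` both sides are `⊤`), the new shadow's (k-ii-loc) is the old T2 restricted to `υ₂⁻¹V`, and `𝒦 ≠ ⊥`
still follows from `K ≠ univ` (`V` is a non-empty open of the irreducible `G`). -/

/-- **The cone-shadow datum with LOCALIZED trace** (k-i), (k-ii-loc), (k-iii)–(k-vi); or the shadow forgotten. [OURS · L1 W4.5b] -/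
def Shadow₃ (G : Scheme.{0}) (E : Set G) (hE : IsClosed E) (K : Set G)
    (X : Scheme.{0}) (σ : X ⟶ P) (jG : G ⟶ X) (𝓔 : X.IdealSheafData) : Prop :=
  K = ∅ ∨ ∃ 𝒦 : X.IdealSheafData,
    -- (k-i) locally principal
    (∀ z : X, (stalkIdeal 𝒦 z).IsPrincipal) ∧
    -- (k-ii-loc) exact reduced trace = the downstairs shadow, ON AN OPEN NEIGHBOURHOOD OF `E`
    (∃ V : G.Opens, E ⊆ (V : Set G) ∧
      (𝒦.comap jG).comap V.ι = (vanishingIdeal (⟨closure K, isClosed_closure⟩ : Closeds G)).comap V.ι) ∧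
    -- (k-iii) the pair is flat over `O`
    Flat ((𝓔 ⊔ 𝒦).subschemeι ≫ σ ≫ q) ∧
    -- (k-iv) conditional regularity of the pair at the special points where `E ∩ closure K` is reduced
    (∀ y : G, jG y ∈ ((𝓔 ⊔ 𝒦).support : Set X) →
      stalkIdeal (vanishingIdeal (⟨E, hE⟩ : Closeds G) ⊔ vanishingIdeal (⟨closure K, isClosed_closure⟩ : Closeds G)) y =
        stalkIdeal (vanishingIdeal (⟨E ∩ closure K, hE.inter isClosed_closure⟩ : Closeds G)) y →
      IsRegularLocalRing (X.presheaf.stalk (jG y) ⧸ stalkIdeal (𝓔 ⊔ 𝒦) (jG y))) ∧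
    -- (k-v) `E` cuts an effective Cartier divisor on the cone `V(𝒦)`
    IsEffectiveCartier (𝓔.comap 𝒦.subschemeι) ∧
    -- (k-vi) the cone cuts an effective Cartier divisor on `V(𝓔)`
    IsEffectiveCartier (𝒦.comap 𝓔.subschemeι)

/-- **The exceptional-surface datum with `Shadow₃`.** [OURS · L1 W4.5b] -/
def Exc₃ (Ruled : RuledDatum P) {F₉ : Scheme.{0}} (Z₉ : Set F₉) (hZ₉ : IsClosed Z₉) {F₁₀ : Scheme.{0}} (υ' : F₁₀ ⟶ F₉)
    (G : Scheme.{0}) (γ : G ⟶ F₁₀) (E : Set G) (hE : IsClosed E) (K : Set G)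
    (X : Scheme.{0}) (σ : X ⟶ P) (jG : G ⟶ X) : Prop :=
  NoRound υ' G γ E ∨ ∃ 𝓔 : X.IdealSheafData,
    𝓔.comap jG = vanishingIdeal (⟨E, hE⟩ : Closeds G) ∧
    (∀ z : X, (stalkIdeal 𝓔 z).IsPrincipal) ∧ Scheme.IsRegular 𝓔.subscheme ∧
    σ '' (𝓔.support : Set X) ⊆ {p : P | ¬ IsGenericPoint p Y} ∧
    Ruled F₉ Z₉ hZ₉ F₁₀ υ' G γ E X σ jG 𝓔 ∧
    Shadow₃ O P q G E hE K X σ jG 𝓔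

/-- **The tower-stage invariant with the localized shadow trace, `Tower.Inv₃`** — THIS is the `INV₁` the assembly instantiates the driver with
after the S7 repair. [OURS · L1 W4.5b] -/
def Inv₃ (Ruled : RuledDatum P) (F₉ : Scheme.{0}) (Z₉ : Set F₉) (hZ₉ : IsClosed Z₉) (F₁₀ : Scheme.{0}) (υ' : F₁₀ ⟶ F₉)
    (G : Scheme.{0}) (γ : G ⟶ F₁₀) (T E K : Set G) : Prop :=
  IsBlowup υ' (vanishingIdeal (⟨Z₉, hZ₉⟩ : Closeds F₉)) ∧ Z₉.Infinite ∧
  IsIntegral G ∧ IsClosed T ∧ IsIrreducible T ∧ IsClosed E ∧ ¬ T ⊆ E ∧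
  ∃ (X : Scheme.{0}) (σ : X ⟶ P) (S : Set X) (jG : G ⟶ X) (tG : G ⟶ Spec (.of k)),
    Ch X σ S ∧ IsIntegral X ∧ IsLocallyNoetherian X ∧ Scheme.IsRegular X ∧ IsDominant (σ ≫ q) ∧
    IsPullback jG tG (σ ≫ q) (Spec.map (CommRingCat.ofHom θ)) ∧ jG '' T = S ∧
    (∀ hE : IsClosed E, Exc₃ O P q Y Ruled Z₉ hZ₉ υ' G γ E hE K X σ jG)

/-- Global ⇒ local: `Shadow₂ ⇒ Shadow₃` (`V := ⊤`). [OURS · pure logic] -/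
theorem shadow₂_shadow₃ {G : Scheme.{0}} {E : Set G} {hE : IsClosed E} {K : Set G} {X : Scheme.{0}} {σ : X ⟶ P} {jG : G ⟶ X}
    {𝓔 : X.IdealSheafData} (h : Shadow₂ O P q G E hE K X σ jG 𝓔) : Shadow₃ O P q G E hE K X σ jG 𝓔 := by
  rcases h with h | ⟨𝒦, h1, h2, h3, h4, h5, h6⟩
  · exact Or.inl h
  · exact Or.inr ⟨𝒦, h1, ⟨⊤, fun _ _ => trivial, by rw [h2]⟩, h3, h4, h5, h6⟩

/-- `Exc₂ ⇒ Exc₃`. [OURS · pure logic] -/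
theorem exc₂_exc₃ (Ruled : RuledDatum P) {F₉ : Scheme.{0}} {Z₉ : Set F₉} {hZ₉ : IsClosed Z₉} {F₁₀ : Scheme.{0}} {υ' : F₁₀ ⟶ F₉}
    {G : Scheme.{0}} {γ : G ⟶ F₁₀} {E : Set G} {hE : IsClosed E} {K : Set G} {X : Scheme.{0}} {σ : X ⟶ P} {jG : G ⟶ X}
    (h : Exc₂ O P q Y Ruled Z₉ hZ₉ υ' G γ E hE K X σ jG) : Exc₃ O P q Y Ruled Z₉ hZ₉ υ' G γ E hE K X σ jG := by
  rcases h with h | ⟨𝓔, h1, h2, h3, h4, h5, h6⟩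
  · exact Or.inl h
  · exact Or.inr ⟨𝓔, h1, h2, h3, h4, h5, shadow₂_shadow₃ O P q h6⟩

/-- `Tower.Inv₂ ⇒ Tower.Inv₃`. [OURS · pure logic] -/
theorem inv₂_inv₃ (Ruled : RuledDatum P) (F₉ : Scheme.{0}) (Z₉ : Set F₉) (hZ₉ : IsClosed Z₉) (F₁₀ : Scheme.{0}) (υ' : F₁₀ ⟶ F₉)
    (G : Scheme.{0}) (γ : G ⟶ F₁₀) (T E K : Set G) (h : Inv₂ O k θ P q Y Ch Ruled F₉ Z₉ hZ₉ F₁₀ υ' G γ T E K) :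
    Inv₃ O k θ P q Y Ch Ruled F₉ Z₉ hZ₉ F₁₀ υ' G γ T E K := by
  obtain ⟨h1, h2, h3, h4, h5, h6, h7, X, σ, S, jG, tG, hCh, hX, hXn, hXr, hdom, hsq, hTS, hexc⟩ := h
  exact ⟨h1, h2, h3, h4, h5, h6, h7, X, σ, S, jG, tG, hCh, hX, hXn, hXr, hdom, hsq, hTS, fun hE => exc₂_exc₃ O P q Y Ruled (hexc hE)⟩

/-- **The driver's (final) clause from `Tower.Inv₃`.** [OURS · pure logic] -/
theorem inv₃_final (Ruled : RuledDatum P) (F₉ : Scheme.{0}) (Z₉ : Set F₉) (hZ₉ : IsClosed Z₉) (F₁₀ : Scheme.{0}) (υ' : F₁₀ ⟶ F₉)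
    (G : Scheme.{0}) (γ : G ⟶ F₁₀) (T E K : Set G) (h : Inv₃ O k θ P q Y Ch Ruled F₉ Z₉ hZ₉ F₁₀ υ' G γ T E K) :
    ∃ (X₉ : Scheme.{0}) (σ₉ : X₉ ⟶ P) (S₉ : Set X₉) (j₉ : G ⟶ X₉) (t₉ : G ⟶ Spec (.of k)),
      Ch X₉ σ₉ S₉ ∧ IsIntegral X₉ ∧ IsLocallyNoetherian X₉ ∧ Scheme.IsRegular X₉ ∧ IsDominant (σ₉ ≫ q) ∧
      IsPullback j₉ t₉ (σ₉ ≫ q) (Spec.map (CommRingCat.ofHom θ)) ∧ j₉ '' T = S₉ ∧ IsClosed T ∧ IsIrreducible T ∧ IsIntegral G := by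
  obtain ⟨-, -, hG, hT, hTirr, -, -, X, σ, S, jG, tG, hCh, hX, hXn, hXr, hdom, hsq, hTS, -⟩ := h
  exact ⟨X, σ, S, jG, tG, hCh, hX, hXn, hXr, hdom, hsq, hTS, hT, hTirr, hG⟩

end Summit.ResolutionOfSingularities.ResolutionOfSingularities.Cruxes.EquisingularLiftNat.Sections.Tower

end
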